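import Summits.Ventures.DiscreteObjects.PP12.FanoFiveKernelSearch

/-!
# PP(12), order 5: the `S₅ × S₂` covering table is valid (one kernel evaluation)
Framing: lottery ticket; floor = certified bounds/negative ranges.

Cell pub-namedobj (venture DiscreteObjects), target (M), designs gen 18. `Kernel.coverCheck` (`FanoFiveKernelSearch`): the table `Kernel.coverTab` has one row
for every feasible weight-2 quadruple (the 1,245 increasing sublists `A` of `Cert.W2` of length 4 with exactly one word containing bit 5 and one containing
bit 6, in the order of `List.sublistsLen`), the row's generator word uses the generators `0–4` only, and the image of `A` under it lies inside one of the
17 representatives `Kernel.reps`. Decided here by `decide +kernel` (≈ 7 s on the farm); READ (without evaluating the table) in `FanoFiveOrderFiveKernel`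
(`cover_of_feasible`). Independently re-checked outside the kernel (designs g18 code/check_cover_independent.py; verify-ref g138 second engine). No `sorry`,
no new axioms.
-/

namespace Summit.Ventures.DiscreteObjects.PP12

namespace FanoFive

namespace Kernel

set_option maxHeartbeats 4000000 in
/-- KERNEL FACT: the covering table of the feasible weight-2 quadruples is valid. -/
theorem coverCheck_eq_true : coverCheck = true := by
  decide +kernel

end Kernel

end FanoFive

end Summit.Ventures.DiscreteObjects.PP12
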